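import Summits.QuantumFields.BalabanUV.Beta.GAN24.FaceWordFullZero
import Summits.QuantumFields.BalabanUV.Beta.GAN24.FaceWordSwapGeneric

/-!
# `BalabanUV.Beta.GAN24.FaceWordFullZeroPatterns` — binder row G-an2-4 ∕ (CONV-C), W-slot (α-0), typer's PART VI row **T6-VAL**, the (γ) hand's letter **K7-0, ALL INDEX PATTERNS OF THE FULL
# LEVEL-`0` TABLE**: for road-P2's full unit-scaled level-`0` fine table `S♮_0 = unitS sf sm (SpureRecAt d Lc ρ cE cVH cΛ 0)` through `X̃♮_0` at the deep period `Lc·N` (generic `cE cVH cΛ`, all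
# units, in-block root, every `d`, `Lc, N ≥ 1`): the DIRECT exchange face word VANISHES on the diagonal patterns `β = ν` ∕ `α = μ` and the SWAPPED word `((S♮_0 ν t ∘ X̃♮_0) ∘ S♮_0 μ rr)` is
# VALUED (`ν ≠ α`, `μ ≠ β`) ∕ vanishes (`ν = α` ∕ `μ = β`) — with `FaceWordFullZero.faceWordFull_zero_value` BOTH exchange words of leaf-02 Part 47's three are known at LEVEL 0 on EVERY pattern
# for the ACTUAL table (E and VH sectors) (G-an2-4 CRUX TEAM (2), seat `b2b-balaban-gan24-formalise-leaf-06` = the (γ) hand, gen 57; journal [GAN24LEAF06-G57-INTENT-6])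

NOT IN PRINT; OUR BOOKKEEPING ([folklore] BY NAME over this seat's (K) `FaceWordNullSector.faceWord_eq_cellPairing_of_null` (any pattern), (L) `FaceWordVHNullCurrents`, (M) `FaceWordFullZero`
(split ∕ covariance ∕ common rate ∕ value), (G) `FaceWordEEDiagZero` (E-sector zeros), and the generic `FaceWordSwapGeneric.swapWord_eq_directWord`; 0 `def`, 0 cited fact, 0 `def … : Prop`,
0 sorry).  HONEST FRAMING (cell contract, verbatim): «discharging `BetaPertH` makes Bałaban's UV stability UNCONDITIONAL — a real constructive-QFT result; it is NOT the continuum limit and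
NOT the Clay problem.»  HONEST DEPENDENCY (verbatim): «continuum YM on T⁴ ⇐ BetaPertH ∧ nine spine estimates (0/9 proved); BetaPertH ⇐ (D1) ∧ (D4) ∧ CAP+tail; G-an2-4 gates asym, D1 and
NE2/3/4.»

WHAT ([folklore]): `faceWordFull_zero_eq_zero_of_right_diag ∕ _of_left_diag` (direct word), **`faceWordFull_swap_zero_value`**, `faceWordFull_swap_zero_eq_zero_of_left_diag ∕ _of_right_diag`.
Asserts NO value of Bałaban's tables beyond these identities; the W word and the `LS`∕`FFsym` pattern sum are the adapter's; discharges NOTHING of `hX` ∕ `hXu` ∕ (C)_{≥1} ∕ `hB0` ∕ `hBF` ∕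
(Q-L); NEVER «G-an2-4 closed» as (CONV-C); NOT D1, NOT `BetaPertH`, NOT continuum, NOT Clay.  2026-08-24; no existing file touched.
-/

noncomputable section

open Finset
open scoped BigOperators
open Literature.MathematicalPhysics.QuantumFieldTheory
open Literature.MathematicalPhysics.QuantumFieldTheory.Balaban1983to89
open Literature.MathematicalPhysics.QuantumFieldTheory.Balaban1983to89.Beta
open ExpKernelCalculus (Site MKer Decays BiLoc shiftK comp)
open OneStepResolventKernel (Fib LocStencil)
open OneStepKernelFamily (KInvStep)
open StepJetData (wilsonA)
open AffineAveraging (box toSite)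
open AveragingHessianKernelsRooted (vhSAt)
open BalabanStepJetsSucc (E2 wVH)
open Summit.QuantumFields.BalabanUV.Beta.AxialDressingRooted (coDressKBmAt one_le_of_neZero)
open Summit.QuantumFields.BalabanUV.Beta.HessKerDressedUnits (unitK unitS)
open Summit.QuantumFields.BalabanUV.Beta.SpineRooted (SpureRecAt)
open Summit.QuantumFields.BalabanUV.Beta.GAN24.FaceWordNullSector (faceWord_eq_cellPairing_of_null)
open Summit.QuantumFields.BalabanUV.Beta.GAN24.FaceWordVHNullCurrents (vhSector_nullL vhSector_nullR)
open Summit.QuantumFields.BalabanUV.Beta.GAN24.FaceWordEEZero (sectorE0_inr_left sectorE0_inr_right dressedStep_invariant_deep0)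
open Summit.QuantumFields.BalabanUV.Beta.GAN24.FaceWordEEDiagZero (cellPairing_zero_eq_zero_of_right_diag_units cellPairing_zero_eq_zero_of_left_diag_units)
open Summit.QuantumFields.BalabanUV.Beta.GAN24.FaceWordFullZero (fullTable0_split fullTable0_translate exists_common_rate_full0 faceWordFull_zero_value)
open Summit.QuantumFields.BalabanUV.Beta.GAN24.FaceWordSwapGeneric (swapWord_eq_directWord)

namespace Summit.QuantumFields.BalabanUV.Beta.GAN24.FaceWordFullZeroPatterns

variable {d : ℕ} {Lc : ℕ} [NeZero Lc] {r : Fin (d + 1) → ℕ}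

/-! ## §1 The direct word of the full table vanishes on the diagonal patterns -/

/-- NOT IN PRINT; OUR BOOKKEEPING.  **RIGHT DIAGONAL (`β = ν`), FULL LEVEL-`0` TABLE: the direct exchange face word is `0`.** -/
theorem faceWordFull_zero_eq_zero_of_right_diag (hr : r ∈ box (d + 1) Lc) (sf sm cE cVH cΛ : ℝ) (N : ℕ) [NeZero N] (μ α ν : Fin (d + 1)) :
    ∑ rr ∈ box (d + 1) (Lc * N), ∑' t : Site (d + 1),
        (if toSite rr μ % ((Lc * N : ℕ) : ℤ) = ((Lc * N : ℕ) : ℤ) - 1 then (1 : ℝ) else 0) * (if t ν % ((Lc * N : ℕ) : ℤ) = ((Lc * N : ℕ) : ℤ) - 1 then (1 : ℝ) else 0) *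
        ∑' yw : Site (d + 1) × Site (d + 1),
          (if yw.1 α % ((Lc * N : ℕ) : ℤ) = ((Lc * N : ℕ) : ℤ) - 1 then (1 : ℝ) else 0) * (if yw.2 ν % ((Lc * N : ℕ) : ℤ) = ((Lc * N : ℕ) : ℤ) - 1 then (1 : ℝ) else 0) *
          comp (comp (unitS sf sm (SpureRecAt d Lc (toSite r) cE cVH cΛ 0) μ (toSite rr))
            (unitK sf sm (coDressKBmAt (toSite r) Lc (KInvStep (d := d) Lc 0))))
            (unitS sf sm (SpureRecAt d Lc (toSite r) cE cVH cΛ 0) ν t)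
            yw.1 yw.2 (Sum.inl α) (Sum.inl ν) = 0 := by
  have hLc : 1 ≤ Lc := one_le_of_neZero Lc
  haveI : NeZero (Lc * N) := ⟨Nat.mul_ne_zero (NeZero.ne Lc) (NeZero.ne N)⟩
  obtain ⟨Cs, Cs₁, Cs₂, CX, m, hm, hS, hS₁, hS₂, hX⟩ := exists_common_rate_full0 (d := d) hr sf sm cE cVH cΛ
  rw [faceWord_eq_cellPairing_of_null (N := Lc * N) hS hS₁ hS₂ hX hm
      (fun κ t s => by
        have h := fullTable0_translate (Lc := Lc) (r := r) sf sm cE cVH cΛ κ t ((N : ℤ) • s)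
        rwa [smul_smul, ← Nat.cast_mul] at h)
      (fun s => dressedStep_invariant_deep0 (Lc := Lc) (r := r) sf sm N s)
      (fun κ t => fullTable0_split (Lc := Lc) (r := r) sf sm cE cVH cΛ κ t)
      (fun κ t y x m' b => sectorE0_inr_left (d := d) sf sm cE κ t y x m' b)
      (fun κ t y x a m' => sectorE0_inr_right (d := d) sf sm cE κ t y x a m') μ ν α ν
      (fun x f => vhSector_nullL (d := d) hLc hr N sf sm cVH μ α x f)
      (fun z g => vhSector_nullR (d := d) hLc hr N sf sm cVH ν ν z g)]
  exact cellPairing_zero_eq_zero_of_right_diag_units sf sm cE N μ α ν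

/-- NOT IN PRINT; OUR BOOKKEEPING.  **LEFT DIAGONAL (`α = μ`), FULL LEVEL-`0` TABLE: the direct exchange face word is `0`.** -/
theorem faceWordFull_zero_eq_zero_of_left_diag (hr : r ∈ box (d + 1) Lc) (sf sm cE cVH cΛ : ℝ) (N : ℕ) [NeZero N] (μ ν β : Fin (d + 1)) :
    ∑ rr ∈ box (d + 1) (Lc * N), ∑' t : Site (d + 1),
        (if toSite rr μ % ((Lc * N : ℕ) : ℤ) = ((Lc * N : ℕ) : ℤ) - 1 then (1 : ℝ) else 0) * (if t ν % ((Lc * N : ℕ) : ℤ) = ((Lc * N : ℕ) : ℤ) - 1 then (1 : ℝ) else 0) *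
        ∑' yw : Site (d + 1) × Site (d + 1),
          (if yw.1 μ % ((Lc * N : ℕ) : ℤ) = ((Lc * N : ℕ) : ℤ) - 1 then (1 : ℝ) else 0) * (if yw.2 β % ((Lc * N : ℕ) : ℤ) = ((Lc * N : ℕ) : ℤ) - 1 then (1 : ℝ) else 0) *
          comp (comp (unitS sf sm (SpureRecAt d Lc (toSite r) cE cVH cΛ 0) μ (toSite rr))
            (unitK sf sm (coDressKBmAt (toSite r) Lc (KInvStep (d := d) Lc 0))))
            (unitS sf sm (SpureRecAt d Lc (toSite r) cE cVH cΛ 0) ν t)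
            yw.1 yw.2 (Sum.inl μ) (Sum.inl β) = 0 := by
  have hLc : 1 ≤ Lc := one_le_of_neZero Lc
  haveI : NeZero (Lc * N) := ⟨Nat.mul_ne_zero (NeZero.ne Lc) (NeZero.ne N)⟩
  obtain ⟨Cs, Cs₁, Cs₂, CX, m, hm, hS, hS₁, hS₂, hX⟩ := exists_common_rate_full0 (d := d) hr sf sm cE cVH cΛ
  rw [faceWord_eq_cellPairing_of_null (N := Lc * N) hS hS₁ hS₂ hX hm
      (fun κ t s => by
        have h := fullTable0_translate (Lc := Lc) (r := r) sf sm cE cVH cΛ κ t ((N : ℤ) • s)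
        rwa [smul_smul, ← Nat.cast_mul] at h)
      (fun s => dressedStep_invariant_deep0 (Lc := Lc) (r := r) sf sm N s)
      (fun κ t => fullTable0_split (Lc := Lc) (r := r) sf sm cE cVH cΛ κ t)
      (fun κ t y x m' b => sectorE0_inr_left (d := d) sf sm cE κ t y x m' b)
      (fun κ t y x a m' => sectorE0_inr_right (d := d) sf sm cE κ t y x a m') μ ν μ β
      (fun x f => vhSector_nullL (d := d) hLc hr N sf sm cVH μ μ x f)
      (fun z g => vhSector_nullR (d := d) hLc hr N sf sm cVH ν β z g)]
  exact cellPairing_zero_eq_zero_of_left_diag_units sf sm cE N μ ν β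

/-! ## §2 The swapped word of the full table: value and diagonal zeros -/

/-- NOT IN PRINT; OUR BOOKKEEPING.  **THE SWAPPED EXCHANGE FACE WORD OF THE FULL LEVEL-`0` TABLE AT THE DEEP PERIOD, VALUED** (`ν ≠ α`, `μ ≠ β`): K4a's bond swap (generic) then
`faceWordFull_zero_value` with the bond directions exchanged. -/
theorem faceWordFull_swap_zero_value (hr : r ∈ box (d + 1) Lc) (sf sm cE cVH cΛ : ℝ) (N : ℕ) [NeZero N] {μ α ν β : Fin (d + 1)} (hνα : ν ≠ α) (hμβ : μ ≠ β) :
    ∑ rr ∈ box (d + 1) (Lc * N), ∑' t : Site (d + 1),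
        (if toSite rr μ % ((Lc * N : ℕ) : ℤ) = ((Lc * N : ℕ) : ℤ) - 1 then (1 : ℝ) else 0) * (if t ν % ((Lc * N : ℕ) : ℤ) = ((Lc * N : ℕ) : ℤ) - 1 then (1 : ℝ) else 0) *
        ∑' yw : Site (d + 1) × Site (d + 1),
          (if yw.1 α % ((Lc * N : ℕ) : ℤ) = ((Lc * N : ℕ) : ℤ) - 1 then (1 : ℝ) else 0) * (if yw.2 β % ((Lc * N : ℕ) : ℤ) = ((Lc * N : ℕ) : ℤ) - 1 then (1 : ℝ) else 0) *
          comp (comp (unitS sf sm (SpureRecAt d Lc (toSite r) cE cVH cΛ 0) ν t)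
            (unitK sf sm (coDressKBmAt (toSite r) Lc (KInvStep (d := d) Lc 0))))
            (unitS sf sm (SpureRecAt d Lc (toSite r) cE cVH cΛ 0) μ (toSite rr))
            yw.1 yw.2 (Sum.inl α) (Sum.inl β) =
      (((sf * sm)⁻¹ * (sf⁻¹ * sf⁻¹) * cE) * ((sf * sm)⁻¹ * (sf⁻¹ * sf⁻¹) * cE)) *
      ((-(1 / 2 : ℝ)) * (1 / 2 : ℝ) * ((sf * sf) *
        ((wVH d Lc 0)⁻¹ *
            ∑ x ∈ box (d + 1) (Lc * N), ∑ b : Fin (d + 1),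
              ((if b = ν then ((((Lc * N : ℕ) : ℝ))⁻¹ * (((Lc * N : ℕ) : ℝ))⁻¹) * ((((toSite x α % ((Lc * N : ℕ) : ℤ) : ℤ) : ℝ) - ((((Lc * N : ℕ) : ℝ)) - 1) / 2)) else 0)
                + (if b = α then (-(((Lc * N : ℕ) : ℝ))⁻¹ * ((((toSite x ν % ((Lc * N : ℕ) : ℤ) : ℤ) : ℝ) - ((((Lc * N : ℕ) : ℝ)) - 1) / 2))) *
                    (if toSite x α % ((Lc * N : ℕ) : ℤ) = ((Lc * N : ℕ) : ℤ) - 1 then (1 : ℝ) else 0) else 0)) *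
              ∑' s : Site (d + 1), ∑ b' : Fin (d + 1), E2 d Lc 0 (toSite x) s (Sum.inl b) (Sum.inl b') *
                ((if b' = μ then ((((Lc * N : ℕ) : ℝ))⁻¹ * (((Lc * N : ℕ) : ℝ))⁻¹) * ((((s β % ((Lc * N : ℕ) : ℤ) : ℤ) : ℝ) - ((((Lc * N : ℕ) : ℝ)) - 1) / 2)) else 0)
                  + (if b' = β then (-(((Lc * N : ℕ) : ℝ))⁻¹ * ((((s μ % ((Lc * N : ℕ) : ℤ) : ℤ) : ℝ) - ((((Lc * N : ℕ) : ℝ)) - 1) / 2))) *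
                      (if s β % ((Lc * N : ℕ) : ℤ) = ((Lc * N : ℕ) : ℤ) - 1 then (1 : ℝ) else 0) else 0)) -
          (wVH d Lc 0)⁻¹ * (((Lc : ℝ) ^ (d + 1) * (Lc : ℝ) ^ (d + 1)) *
            ∑ y ∈ box (d + 1) N, ∑ a : Fin (d + 1),
              ((if a = ν then (((N : ℝ))⁻¹ * ((N : ℝ))⁻¹) * ((((toSite y α % (N : ℤ)) : ℤ) : ℝ) - ((N : ℝ) - 1) / 2) else 0)
                + (if a = α then (-((N : ℝ))⁻¹ * ((((toSite y ν % (N : ℤ)) : ℤ) : ℝ) - ((N : ℝ) - 1) / 2)) *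
                    (if toSite y α % (N : ℤ) = (N : ℤ) - 1 then (1 : ℝ) else 0) else 0)) *
              ∑' s : Site (d + 1), ∑ b' : Fin (d + 1), E2 d Lc 1 (toSite y) s (Sum.inl a) (Sum.inl b') *
                ((if b' = μ then (((N : ℝ))⁻¹ * ((N : ℝ))⁻¹) * ((((s β % (N : ℤ)) : ℤ) : ℝ) - ((N : ℝ) - 1) / 2) else 0)
                  + (if b' = β then (-((N : ℝ))⁻¹ * ((((s μ % (N : ℤ)) : ℤ) : ℝ) - ((N : ℝ) - 1) / 2)) *
                      (if s β % (N : ℤ) = (N : ℤ) - 1 then (1 : ℝ) else 0) else 0)))))) := by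
  haveI : NeZero (Lc * N) := ⟨Nat.mul_ne_zero (NeZero.ne Lc) (NeZero.ne N)⟩
  obtain ⟨Cs, Cs₁, Cs₂, CX, m, hm, hS, hS₁, hS₂, hX⟩ := exists_common_rate_full0 (d := d) hr sf sm cE cVH cΛ
  rw [swapWord_eq_directWord (N := Lc * N) hS hX hm
      (fun κ t s => by
        have h := fullTable0_translate (Lc := Lc) (r := r) sf sm cE cVH cΛ κ t ((N : ℤ) • s)
        rwa [smul_smul, ← Nat.cast_mul] at h)
      (fun s => dressedStep_invariant_deep0 (Lc := Lc) (r := r) sf sm N s) μ ν α β]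
  exact faceWordFull_zero_value hr sf sm cE cVH cΛ N hνα hμβ

/-- NOT IN PRINT; OUR BOOKKEEPING.  **THE SWAPPED WORD VANISHES FOR `ν = α`** (its left current is diagonal). -/
theorem faceWordFull_swap_zero_eq_zero_of_left_diag (hr : r ∈ box (d + 1) Lc) (sf sm cE cVH cΛ : ℝ) (N : ℕ) [NeZero N] (μ ν β : Fin (d + 1)) :
    ∑ rr ∈ box (d + 1) (Lc * N), ∑' t : Site (d + 1),
        (if toSite rr μ % ((Lc * N : ℕ) : ℤ) = ((Lc * N : ℕ) : ℤ) - 1 then (1 : ℝ) else 0) * (if t ν % ((Lc * N : ℕ) : ℤ) = ((Lc * N : ℕ) : ℤ) - 1 then (1 : ℝ) else 0) *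
        ∑' yw : Site (d + 1) × Site (d + 1),
          (if yw.1 ν % ((Lc * N : ℕ) : ℤ) = ((Lc * N : ℕ) : ℤ) - 1 then (1 : ℝ) else 0) * (if yw.2 β % ((Lc * N : ℕ) : ℤ) = ((Lc * N : ℕ) : ℤ) - 1 then (1 : ℝ) else 0) *
          comp (comp (unitS sf sm (SpureRecAt d Lc (toSite r) cE cVH cΛ 0) ν t)
            (unitK sf sm (coDressKBmAt (toSite r) Lc (KInvStep (d := d) Lc 0))))
            (unitS sf sm (SpureRecAt d Lc (toSite r) cE cVH cΛ 0) μ (toSite rr))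
            yw.1 yw.2 (Sum.inl ν) (Sum.inl β) = 0 := by
  haveI : NeZero (Lc * N) := ⟨Nat.mul_ne_zero (NeZero.ne Lc) (NeZero.ne N)⟩
  obtain ⟨Cs, Cs₁, Cs₂, CX, m, hm, hS, hS₁, hS₂, hX⟩ := exists_common_rate_full0 (d := d) hr sf sm cE cVH cΛ
  rw [swapWord_eq_directWord (N := Lc * N) hS hX hm
      (fun κ t s => by
        have h := fullTable0_translate (Lc := Lc) (r := r) sf sm cE cVH cΛ κ t ((N : ℤ) • s)
        rwa [smul_smul, ← Nat.cast_mul] at h)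
      (fun s => dressedStep_invariant_deep0 (Lc := Lc) (r := r) sf sm N s) μ ν ν β]
  exact faceWordFull_zero_eq_zero_of_left_diag hr sf sm cE cVH cΛ N ν μ β

/-- NOT IN PRINT; OUR BOOKKEEPING.  **THE SWAPPED WORD VANISHES FOR `μ = β`** (its right current is diagonal). -/
theorem faceWordFull_swap_zero_eq_zero_of_right_diag (hr : r ∈ box (d + 1) Lc) (sf sm cE cVH cΛ : ℝ) (N : ℕ) [NeZero N] (μ ν α : Fin (d + 1)) :
    ∑ rr ∈ box (d + 1) (Lc * N), ∑' t : Site (d + 1),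
        (if toSite rr μ % ((Lc * N : ℕ) : ℤ) = ((Lc * N : ℕ) : ℤ) - 1 then (1 : ℝ) else 0) * (if t ν % ((Lc * N : ℕ) : ℤ) = ((Lc * N : ℕ) : ℤ) - 1 then (1 : ℝ) else 0) *
        ∑' yw : Site (d + 1) × Site (d + 1),
          (if yw.1 α % ((Lc * N : ℕ) : ℤ) = ((Lc * N : ℕ) : ℤ) - 1 then (1 : ℝ) else 0) * (if yw.2 μ % ((Lc * N : ℕ) : ℤ) = ((Lc * N : ℕ) : ℤ) - 1 then (1 : ℝ) else 0) *
          comp (comp (unitS sf sm (SpureRecAt d Lc (toSite r) cE cVH cΛ 0) ν t)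
            (unitK sf sm (coDressKBmAt (toSite r) Lc (KInvStep (d := d) Lc 0))))
            (unitS sf sm (SpureRecAt d Lc (toSite r) cE cVH cΛ 0) μ (toSite rr))
            yw.1 yw.2 (Sum.inl α) (Sum.inl μ) = 0 := by
  haveI : NeZero (Lc * N) := ⟨Nat.mul_ne_zero (NeZero.ne Lc) (NeZero.ne N)⟩
  obtain ⟨Cs, Cs₁, Cs₂, CX, m, hm, hS, hS₁, hS₂, hX⟩ := exists_common_rate_full0 (d := d) hr sf sm cE cVH cΛ
  rw [swapWord_eq_directWord (N := Lc * N) hS hX hm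
      (fun κ t s => by
        have h := fullTable0_translate (Lc := Lc) (r := r) sf sm cE cVH cΛ κ t ((N : ℤ) • s)
        rwa [smul_smul, ← Nat.cast_mul] at h)
      (fun s => dressedStep_invariant_deep0 (Lc := Lc) (r := r) sf sm N s) μ ν α μ]
  exact faceWordFull_zero_eq_zero_of_right_diag hr sf sm cE cVH cΛ N ν α μ

end Summit.QuantumFields.BalabanUV.Beta.GAN24.FaceWordFullZeroPatterns

end
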